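import Summits.BirchSwinnertonDyer.BirchSwinnertonDyer.Theorems.ManinLocalTwoThreeIntegralCuspPresentation
import Summits.BirchSwinnertonDyer.Rank1Residual.ManinAdditive.UDCKummerWitnessLineB
import Literature.NumberTheory.EllipticCurves.ModularParamYRationality
import HarnessLib

/-!
# (RATB) `KummerMinimalParamPresentation`: `t_W∘φ` is a ratio of INTEGER modular forms

Cell `bsd-f2-manin`, p3 gen 16, crux C3 (stmt-22968), B-line piece (RATB) of `UDCKummerWitnessLineB` BY NAME, without the
`K_N`-descent: `t_W∘φ = −2c(X − c²b₂/12)/(Y − a₁c(X − c²b₂/12) − c³a₃)`, `X = ℘_{Λ'}(u) = F/G` (`Λ' = c⁻¹Λ_W`, explicit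
presentation), `Y = ℘'_{Λ'}(u) = bracketCusp F G/(G²f)`; so `t_W∘φ = N₁/D₁` with CUSP forms of weight `3k+2` whose Laurent
ratio is `Aut(ℂ)`-fixed (`mapLaurent_xFn/yFn`), hence `= Bn/Bd` with INTEGER forms (`exists_int_cuspForm_presentation`);
pointwise off `φ⁻¹(O) ∪ {y_W∘φ = 0}` where `G·f ≠ 0`, elsewhere by continuity; weight `12m` via the factor `f⁵`; if `D₁ = 0`
the statement is vacuous.  Everything is proved; no named fact.  BSD is not proved by this; C2/C3 are not proved by this.
-/

set_option linter.dupNamespace false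

noncomputable section

open Complex Filter Topology Set Function
open UpperHalfPlane hiding I
open scoped Real Topology Manifold MatrixGroups PeriodPair ModularForm
open ModularForm EisensteinSeries SlashInvariantForm ModularFormClass CongruenceSubgroup PowerSeries
open Literature.NumberTheory.EllipticCurves Literature.NumberTheory.EllipticCurves.ModularForms
open Summit.BirchSwinnertonDyer.Rank1Residual.ManinAdditive
open Summit.BirchSwinnertonDyer.Rank1Residual.ManinAdditive.KummerCubeMonodromy
open Summit.BirchSwinnertonDyer.Rank1Residual.ManinAdditive.UDCKummerWitnessLine

namespace Summit.BirchSwinnertonDyer.BirchSwinnertonDyer.Theorems.ManinLocalTwoThree.ParamPoleJ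

variable {N : ℕ} [NeZero N]

/-! ### §1 Density: an identity off the zeros of a nonzero cusp form holds at every regular point -/

omit [NeZero N] in
/-- If `Q` is continuous at `z₀` and vanishes at all points of a punctured neighbourhood where a fixed nonzero cusp form
`H` does not vanish, then `Q z₀ = 0` (zeros of `H` are isolated). [folklore] -/
theorem eq_zero_of_continuousAt_of_eventually {w : ℤ} (H : CuspForm (Gamma0 N) w) (hH : H ≠ 0) {z₀ : ℂ} (hz₀ : 0 < z₀.im)
    {Q : ℂ → ℂ} (hQ : ContinuousAt Q z₀) (h : ∀ᶠ z in 𝓝[≠] z₀, (⇑H ∘ ofComplex) z ≠ 0 → Q z = 0) : Q z₀ = 0 := by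
  have hev : Q =ᶠ[𝓝[≠] z₀] fun _ ↦ (0 : ℂ) := by
    filter_upwards [h, eventually_ne_zero_of_cuspForm_ne_zero H hH hz₀] with z h1 h2
    exact h1 h2
  exact tendsto_nhds_unique (hQ.tendsto.mono_left nhdsWithin_le_nhds) (tendsto_const_nhds.congr' hev.symm)

/-- A nonzero modular form of weight `12 = 12·1` for `Γ₀(N)` with INTEGER `q`-expansion: `Δ`. [folklore] -/
theorem exists_int_modularForm_twelve :
    ∃ (Bd : ModularForm (Gamma0 N) (12 * ((1 : ℕ) : ℤ))) (bd : ℕ → ℤ), Bd ≠ 0 ∧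
      ∀ τ : ℍ, HasSum (fun n : ℕ ↦ (bd n : ℂ) * Complex.exp (2 * Real.pi * Complex.I * (τ : ℂ) * n)) (Bd τ) := by
  have h12 : (12 : ℤ) = 12 * ((1 : ℕ) : ℤ) := by norm_num
  have hb : ∀ m, (qExpansion 1 ⇑((ofLevelOne (Gamma0 N) delta).mcast h12)).coeff m =
      ((PowerSeries.X * formalDeltaUnit).coeff m : ℤ) := fun m ↦ by
    rw [show (⇑((ofLevelOne (Gamma0 N) delta).mcast h12) : ℍ → ℂ) = ModularForm.discriminant from rfl,
      qExpansion_discriminant, coeff_map]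
    rfl
  have hne : (ofLevelOne (Gamma0 N) delta).mcast h12 ≠ 0 := by
    intro h0
    have h1 := DFunLike.congr_fun h0 UpperHalfPlane.I
    rw [ModularForm.coe_mcast, coe_ofLevelOne, delta_apply, ModularForm.zero_apply] at h1
    exact ModularForm.discriminant_ne_zero _ h1
  exact ⟨_, _, hne, hasSum_int_qExpansion _ _ hb⟩

/-! ### §1b The two cusp forms presenting `t_W∘φ`: values and `Aut(ℂ)`-fixed ratio -/

section Forms

variable {f : CuspForm (Gamma0 N) 2} {L : PeriodPair} {k : ℤ} {F G : CuspForm (Gamma0 N) k}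

/-- Value of the numerator form `G·(cn·(F − κ₀G)·(G f))` at a regular point. [folklore] -/
theorem paramNum_apply (h : IsXPresentation f L F G) (cn κ₀ : ℂ) {τ : ℍ} (hτ : eichlerIntegral f τ ∉ L.lattice) :
    (G.mulModularForm (cn • (((F : ModularForm (Gamma0 N) k) - κ₀ • (G : ModularForm (Gamma0 N) k)).mul
      ((G : ModularForm (Gamma0 N) k).mul (f : ModularForm (Gamma0 N) 2))))) τ =
      G τ ^ 3 * f τ * (cn * (℘[L] (eichlerIntegral f τ) - κ₀)) := by
  have hF : F τ = ℘[L] (eichlerIntegral f τ) * G τ := (h.2 τ hτ).symm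
  rw [CuspForm.coe_mulModularForm, Pi.mul_apply]
  simp only [ModularForm.coe_sub, Pi.sub_apply, IsGLPos.smul_apply, smul_eq_mul, ModularForm.coe_mul, Pi.mul_apply]
  change G τ * (cn * ((F τ - κ₀ * G τ) * (G τ * f τ))) = _; rw [hF]; ring

/-- Value of the denominator form `G·(bracket − a₁c·(F − κ₀G)·(G f) − c₃·G·(G f))` at a regular point. [folklore] -/
theorem paramDen_apply (h : IsXPresentation f L F G) (a1c κ₀ c3 : ℂ) {τ : ℍ} (hτ : eichlerIntegral f τ ∉ L.lattice) :
    (G.mulModularForm ((bracketCusp F G : ModularForm (Gamma0 N) (k + (k + 2))) -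
      a1c • (((F : ModularForm (Gamma0 N) k) - κ₀ • (G : ModularForm (Gamma0 N) k)).mul
        ((G : ModularForm (Gamma0 N) k).mul (f : ModularForm (Gamma0 N) 2))) -
      c3 • ((G : ModularForm (Gamma0 N) k).mul ((G : ModularForm (Gamma0 N) k).mul (f : ModularForm (Gamma0 N) 2))))) τ =
      G τ ^ 3 * f τ * (℘'[L] (eichlerIntegral f τ) - a1c * (℘[L] (eichlerIntegral f τ) - κ₀) - c3) := by
  have hF : F τ = ℘[L] (eichlerIntegral f τ) * G τ := (h.2 τ hτ).symm
  have hBr : bracketCusp F G τ = ℘'[L] (eichlerIntegral f τ) * (G τ * (G τ * f τ)) := by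
    have := (h.bracket_eventuallyEq (z₀ := (τ : ℂ)) τ.im_pos (by rwa [ofComplex_apply])).self_of_nhds
    simpa only [comp_apply, ofComplex_apply] using this
  rw [CuspForm.coe_mulModularForm, Pi.mul_apply]
  simp only [ModularForm.coe_sub, Pi.sub_apply, IsGLPos.smul_apply, smul_eq_mul, ModularForm.coe_mul, Pi.mul_apply]
  change G τ * (bracketCusp F G τ - a1c * ((F τ - κ₀ * G τ) * (G τ * f τ)) - c3 * (G τ * (G τ * f τ))) = _; rw [hF, hBr]; ring

/-- **The Laurent ratio of the two forms is `Aut(ℂ)`-fixed** (it is `cn(x̂ − κ₀)/(ŷ − a₁c(x̂ − κ₀) − c₃)` with `x̂, ŷ`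
fixed — tree `mapLaurent_xFn`, `mapLaurent_yFn` — and rational constants). [cite: ShimuraIATAF1971, Thm. 7.14] -/
theorem mapLaurent_paramRatio (h : IsXPresentation f L F G) (hf : f ≠ 0) (hrat : ∀ m, ∃ q : ℚ, (q : ℂ) = cuspCoeff f m)
    (hg₂ : ∃ q : ℚ, (q : ℂ) = L.g₂) (hg₃ : ∃ q : ℚ, (q : ℂ) = L.g₃) {cn κ₀ a1c c3 : ℂ}
    (hcn : ∃ q : ℚ, (q : ℂ) = cn) (hκ₀ : ∃ q : ℚ, (q : ℂ) = κ₀) (ha1c : ∃ q : ℚ, (q : ℂ) = a1c) (hc3 : ∃ q : ℚ, (q : ℂ) = c3)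
    (σ : ℂ ≃+* ℂ) :
    mapLaurent (σ : ℂ →+* ℂ) (qExpansionL N
        ((G.mulModularForm (cn • (((F : ModularForm (Gamma0 N) k) - κ₀ • (G : ModularForm (Gamma0 N) k)).mul
          ((G : ModularForm (Gamma0 N) k).mul (f : ModularForm (Gamma0 N) 2))))) :
          ModularForm (Gamma0 N) (k + (k + (k + 2)))) /
        qExpansionL N ((G.mulModularForm ((bracketCusp F G : ModularForm (Gamma0 N) (k + (k + 2))) -
          a1c • (((F : ModularForm (Gamma0 N) k) - κ₀ • (G : ModularForm (Gamma0 N) k)).mul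
            ((G : ModularForm (Gamma0 N) k).mul (f : ModularForm (Gamma0 N) 2))) -
          c3 • ((G : ModularForm (Gamma0 N) k).mul ((G : ModularForm (Gamma0 N) k).mul (f : ModularForm (Gamma0 N) 2))))) :
          ModularForm (Gamma0 N) (k + (k + (k + 2))))) =
      qExpansionL N
        ((G.mulModularForm (cn • (((F : ModularForm (Gamma0 N) k) - κ₀ • (G : ModularForm (Gamma0 N) k)).mul
          ((G : ModularForm (Gamma0 N) k).mul (f : ModularForm (Gamma0 N) 2))))) :
          ModularForm (Gamma0 N) (k + (k + (k + 2)))) /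
        qExpansionL N ((G.mulModularForm ((bracketCusp F G : ModularForm (Gamma0 N) (k + (k + 2))) -
          a1c • (((F : ModularForm (Gamma0 N) k) - κ₀ • (G : ModularForm (Gamma0 N) k)).mul
            ((G : ModularForm (Gamma0 N) k).mul (f : ModularForm (Gamma0 N) 2))) -
          c3 • ((G : ModularForm (Gamma0 N) k).mul ((G : ModularForm (Gamma0 N) k).mul (f : ModularForm (Gamma0 N) 2))))) :
          ModularForm (Gamma0 N) (k + (k + (k + 2)))) := by
  set Fm := (F : ModularForm (Gamma0 N) k)
  set Gm := (G : ModularForm (Gamma0 N) k)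
  set fm := (f : ModularForm (Gamma0 N) 2)
  set Brm := (bracketCusp F G : ModularForm (Gamma0 N) (k + (k + 2)))
  set X : LaurentSeries ℂ := ((h.xFn : modularFunctionField N) : LaurentSeries ℂ) with hXdef
  set Y : LaurentSeries ℂ := ((h.yFn hf : modularFunctionField N) : LaurentSeries ℂ) with hYdef
  have hGm0 : qExpansionL N Gm ≠ 0 := (qExpansionL_eq_zero_iff N Gm).not.mpr h.modularForm_ne_zero
  have hfm0 : qExpansionL N fm ≠ 0 := fun h0 ↦ hf (by
    rw [qExpansionL_eq_zero_iff] at h0; apply DFunLike.ext; intro τ; exact DFunLike.congr_fun h0 τ)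
  have hXmul : X * qExpansionL N Gm = qExpansionL N Fm := mkFn_mul _ _ h.modularForm_ne_zero
  have hYmul : Y * (qExpansionL N Gm * (qExpansionL N Gm * qExpansionL N fm)) = qExpansionL N Brm := by
    have := mkFn_mul (bracketCusp F G : ModularForm (Gamma0 N) (k + (k + 2))) h.yDen (h.yDen_ne_zero hf)
    rw [← IsXPresentation.yFn_def] at this
    rw [hYdef, ← this, IsXPresentation.yDen, qExpansionL_mul, qExpansionL_mul]
  set M : LaurentSeries ℂ := qExpansionL N Gm * (qExpansionL N Gm * (qExpansionL N Gm * qExpansionL N fm)) with hM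
  have hM0 : M ≠ 0 := mul_ne_zero hGm0 (mul_ne_zero hGm0 (mul_ne_zero hGm0 hfm0))
  have hNq : qExpansionL N ((G.mulModularForm (cn • ((Fm - κ₀ • Gm).mul (Gm.mul fm)))) : ModularForm (Gamma0 N) (k + (k + (k + 2)))) =
      M * (HahnSeries.C cn * (X - HahnSeries.C κ₀)) := by
    rw [show qExpansionL N ((G.mulModularForm (cn • ((Fm - κ₀ • Gm).mul (Gm.mul fm)))) : ModularForm (Gamma0 N) (k + (k + (k + 2))))
        = qExpansionL N (Gm.mul (cn • ((Fm - κ₀ • Gm).mul (Gm.mul fm)))) from rfl,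
      qExpansionL_mul, qExpansionL_smul, ← HahnSeries.C_mul_eq_smul, qExpansionL_mul, qExpansionL_mul, sub_eq_add_neg,
      qExpansionL_add, qExpansionL_neg, qExpansionL_smul, ← HahnSeries.C_mul_eq_smul, ← hXmul, hM]
    ring
  have hDq : qExpansionL N ((G.mulModularForm (Brm - a1c • ((Fm - κ₀ • Gm).mul (Gm.mul fm)) - c3 • (Gm.mul (Gm.mul fm)))) :
      ModularForm (Gamma0 N) (k + (k + (k + 2)))) =
      M * (Y - HahnSeries.C a1c * (X - HahnSeries.C κ₀) - HahnSeries.C c3) := by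
    rw [show qExpansionL N ((G.mulModularForm (Brm - a1c • ((Fm - κ₀ • Gm).mul (Gm.mul fm)) - c3 • (Gm.mul (Gm.mul fm)))) :
        ModularForm (Gamma0 N) (k + (k + (k + 2)))) =
        qExpansionL N (Gm.mul (Brm - a1c • ((Fm - κ₀ • Gm).mul (Gm.mul fm)) - c3 • (Gm.mul (Gm.mul fm)))) from rfl,
      qExpansionL_mul]
    simp only [sub_eq_add_neg, qExpansionL_add, qExpansionL_neg, qExpansionL_smul, ← HahnSeries.C_mul_eq_smul, qExpansionL_mul]
    rw [← hXmul, ← hYmul, hM]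
    ring
  obtain ⟨q₂, hq₂⟩ := hg₂
  obtain ⟨q₃, hq₃⟩ := hg₃
  have hσ₂ : σ L.g₂ = L.g₂ := by rw [← hq₂, map_ratCast]
  have hσ₃ : σ L.g₃ = L.g₃ := by rw [← hq₃, map_ratCast]
  have hXσ : mapLaurent (σ : ℂ →+* ℂ) X = X := h.mapLaurent_xFn hf hrat σ hσ₂ hσ₃
  have hYσ : mapLaurent (σ : ℂ →+* ℂ) Y = Y := h.mapLaurent_yFn hf hrat σ hσ₂ hσ₃
  obtain ⟨qn, rfl⟩ := hcn
  obtain ⟨qκ, rfl⟩ := hκ₀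
  obtain ⟨qa, rfl⟩ := ha1c
  obtain ⟨qc, rfl⟩ := hc3
  rw [hNq, hDq, mul_div_mul_left _ _ hM0]
  simp only [map_div₀, map_mul, map_sub, hXσ, hYσ, map_ratCast]

end Forms

/-! ### §2 The core: from a presentation of `x` over `c⁻¹Λ_W` to integer forms presenting `t_W∘φ` -/

section Core

variable {W : WeierstrassCurve ℚ} (D : ModularParametrizationData W N) {L' : PeriodPair} {k : ℤ}
  {F G : CuspForm (Gamma0 N) k}

/-- **Core of (RATB).**  Given a presentation `x·G = F` of `℘_{Λ'}(u)`, `Λ' = c⁻¹Λ_W` (so that `℘_{Λ'}(u) = shortX`,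
`℘'_{Λ'}(u) = 2·shortY`), with `g₂(Λ'), g₃(Λ') ∈ ℚ` and weight `12e`: either `y_W∘φ` vanishes at every point off `φ⁻¹(O)`,
or `t_W∘φ = Bn/Bd` with `Bd ≠ 0` of weight `12(3e+1)` and integer `q`-expansion, pointwise off `φ⁻¹(O) ∪ {y_W∘φ = 0}`.
[cite: ShimuraIATAF1971, Thm. 3.52 and Thm. 7.14] -/
theorem ratb_core (h : IsXPresentation D.f L' F G) (e : ℕ) (hk : k = ((12 * e : ℕ) : ℤ)) (hmem : ∀ x : ℂ, x ∈ L'.lattice ↔ (D.c : ℂ) * x ∈ D.L.lattice)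
    (hq₂ : ∃ q : ℚ, (q : ℂ) = L'.g₂) (hq₃ : ∃ q : ℚ, (q : ℂ) = L'.g₃)
    (hPx : ∀ τ : ℍ, ℘[L'] (eichlerIntegral D.f τ) = shortX D τ)
    (hPy : ∀ τ : ℍ, ℘'[L'] (eichlerIntegral D.f τ) = 2 * shortY D τ) :
    (∀ τ : ℍ, (D.c : ℂ) * eichlerIntegral D.f τ ∉ D.L.lattice → minimalY D τ = 0) ∨
    ∃ (Bn Bd : ModularForm (Gamma0 N) (12 * ((3 * e + 1 : ℕ) : ℤ))) (bd : ℕ → ℤ), Bd ≠ 0 ∧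
      (∀ τ : ℍ, HasSum (fun n : ℕ ↦ (bd n : ℂ) * Complex.exp (2 * Real.pi * Complex.I * (τ : ℂ) * n)) (Bd τ)) ∧
      ∀ τ : ℍ, (D.c : ℂ) * eichlerIntegral D.f τ ∉ D.L.lattice → minimalY D τ ≠ 0 →
        Bd τ * minimalParam D τ = Bn τ := by
  classical
  subst hk
  have hf : D.f ≠ 0 := D.isNewformOf.1.ne_zero
  have hrat : ∀ m, ∃ q : ℚ, (q : ℂ) = cuspCoeff D.f m := fun m ↦
    ⟨W.LFunction m, by rw [D.isNewformOf.2 m]; push_cast; rfl⟩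
  -- the two cusp forms
  set Fm : ModularForm (Gamma0 N) (((12 * e : ℕ) : ℤ)) := (F : ModularForm (Gamma0 N) (((12 * e : ℕ) : ℤ))) with hFm
  set Gm : ModularForm (Gamma0 N) (((12 * e : ℕ) : ℤ)) := (G : ModularForm (Gamma0 N) (((12 * e : ℕ) : ℤ))) with hGm
  set fm : ModularForm (Gamma0 N) 2 := (D.f : ModularForm (Gamma0 N) 2) with hfm
  set Brm : ModularForm (Gamma0 N) (((12 * e : ℕ) : ℤ) + (((12 * e : ℕ) : ℤ) + 2)) :=
    (bracketCusp F G : ModularForm (Gamma0 N) (((12 * e : ℕ) : ℤ) + (((12 * e : ℕ) : ℤ) + 2))) with hBrm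
  set κ₀ : ℂ := (D.c : ℂ) ^ 2 * (W.b₂ : ℂ) / 12 with hκ₀
  set N₁ : CuspForm (Gamma0 N) (((12 * e : ℕ) : ℤ) + (((12 * e : ℕ) : ℤ) + (((12 * e : ℕ) : ℤ) + 2))) :=
    G.mulModularForm ((-2 * (D.c : ℂ)) • ((Fm - κ₀ • Gm).mul (Gm.mul fm))) with hN₁
  set D₁ : CuspForm (Gamma0 N) (((12 * e : ℕ) : ℤ) + (((12 * e : ℕ) : ℤ) + (((12 * e : ℕ) : ℤ) + 2))) :=
    G.mulModularForm (Brm - ((W.a₁ : ℂ) * D.c) • ((Fm - κ₀ • Gm).mul (Gm.mul fm)) -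
      ((D.c : ℂ) ^ 3 * W.a₃) • (Gm.mul (Gm.mul fm))) with hD₁
  -- pointwise values at regular points
  have hreg : ∀ τ : ℍ, eichlerIntegral D.f τ ∉ L'.lattice →
      N₁ τ = G τ ^ 3 * D.f τ * (-2 * (D.c : ℂ) * (shortX D τ - κ₀)) ∧
      D₁ τ = G τ ^ 3 * D.f τ * (2 * minimalY D τ) := by
    intro τ hτ
    exact ⟨by rw [hN₁, paramNum_apply h _ _ hτ, hPx], by rw [hD₁, paramDen_apply h _ _ _ hτ, hPx, hPy, minimalY]; ring⟩
  -- the nonzero cusp form `G·f` (its zeros are the exceptional regular points)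
  set Gf : CuspForm (Gamma0 N) (((12 * e : ℕ) : ℤ) + 2) := G.mulModularForm fm with hGf
  have hfm0 : qExpansionL N fm ≠ 0 := fun h0 ↦ hf (by
    rw [qExpansionL_eq_zero_iff] at h0; apply DFunLike.ext; intro τ; exact DFunLike.congr_fun h0 τ)
  have hGf0 : Gf ≠ 0 := by
    intro h0
    have h1 : qExpansionL N ((Gf : ModularForm (Gamma0 N) (((12 * e : ℕ) : ℤ) + 2))) = 0 := by
      rw [qExpansionL_eq_zero_iff]; apply DFunLike.ext; intro τ; exact DFunLike.congr_fun h0 τ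
    have h2 : qExpansionL N ((Gf : ModularForm (Gamma0 N) (((12 * e : ℕ) : ℤ) + 2))) = qExpansionL N Gm * qExpansionL N fm := by
      rw [← qExpansionL_mul]; rfl
    rw [h2, mul_eq_zero, qExpansionL_eq_zero_iff] at h1
    exact h1.elim h.modularForm_ne_zero hfm0
  have hGfτ : ∀ τ : ℍ, Gf τ = G τ * D.f τ := fun τ ↦ rfl
  -- analyticity of `shortX`, `shortY`, `minimalY` at regular points
  have hXan : ∀ {z : ℂ}, 0 < z.im → (D.c : ℂ) * eichlerIntegral D.f (ofComplex z) ∉ D.L.lattice →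
      AnalyticAt ℂ (fun w ↦ shortX D (ofComplex w)) z ∧ AnalyticAt ℂ (fun w ↦ shortY D (ofComplex w)) z := by
    intro z hz hzL
    have hu : AnalyticAt ℂ (fun w ↦ (D.c : ℂ) * eichlerIntegral D.f (ofComplex w)) z :=
      analyticAt_const.mul (analyticAt_eichlerIntegral_comp_ofComplex D.f hz)
    exact ⟨analyticAt_const.mul ((D.L.analyticOnNhd_weierstrassP _ hzL).comp_of_eq hu rfl),
      (analyticAt_const.mul ((D.L.analyticOnNhd_derivWeierstrassP _ hzL).comp_of_eq hu rfl)).div_const⟩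
  have hYan : ∀ {z : ℂ}, 0 < z.im → (D.c : ℂ) * eichlerIntegral D.f (ofComplex z) ∉ D.L.lattice →
      AnalyticAt ℂ (fun w ↦ minimalY D (ofComplex w)) z := by
    intro z hz hzL
    obtain ⟨h1, h2⟩ := hXan hz hzL
    simp only [minimalY]
    exact (h2.sub ((analyticAt_const.mul (h1.sub analyticAt_const)))).sub analyticAt_const
  have hopen : ∀ {z₀ : ℂ}, 0 < z₀.im → (D.c : ℂ) * eichlerIntegral D.f (ofComplex z₀) ∉ D.L.lattice →
      ∀ᶠ z in 𝓝 z₀, 0 < z.im ∧ (D.c : ℂ) * eichlerIntegral D.f (ofComplex z) ∉ D.L.lattice := by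
    intro z₀ hz₀ hz₀L
    have hz₀L' : eichlerIntegral D.f (ofComplex z₀) ∉ L'.lattice := fun h ↦ hz₀L ((hmem _).mp h)
    filter_upwards [(isOpen_setOf_eichlerIntegral_notMem_lattice D.f L').mem_nhds ⟨hz₀, hz₀L'⟩] with z hz
    exact ⟨hz.1, fun h ↦ hz.2 ((hmem _).mpr h)⟩
  -- case `D₁ = 0`: `y_W∘φ ≡ 0` off `φ⁻¹(O)`
  by_cases hD₁0 : D₁ = 0
  · refine Or.inl fun τ hτ ↦ ?_
    have key : ∀ z : ℂ, 0 < z.im → (D.c : ℂ) * eichlerIntegral D.f (ofComplex z) ∉ D.L.lattice →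
        (⇑Gf ∘ ofComplex) z ≠ 0 → minimalY D (ofComplex z) = 0 := by
      intro z hz hzL hGz
      have hzL' : eichlerIntegral D.f (ofComplex z) ∉ L'.lattice := fun h ↦ hzL ((hmem _).mp h)
      have h2 := (hreg (ofComplex z) hzL').2
      rw [hD₁0, CuspForm.zero_apply] at h2
      rw [comp_apply, hGfτ] at hGz
      have : G (ofComplex z) ^ 3 * D.f (ofComplex z) ≠ 0 :=
        mul_ne_zero (pow_ne_zero _ (left_ne_zero_of_mul hGz)) (right_ne_zero_of_mul hGz)
      have h3 := (mul_eq_zero.mp h2.symm).resolve_left this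
      linear_combination h3 / 2
    have h0 := eq_zero_of_continuousAt_of_eventually Gf hGf0 (z₀ := (τ : ℂ)) τ.im_pos
      (Q := fun w ↦ minimalY D (ofComplex w)) (hYan τ.im_pos (by rwa [ofComplex_apply])).continuousAt
      (by
        filter_upwards [nhdsWithin_le_nhds (hopen (z₀ := (τ : ℂ)) τ.im_pos (by rwa [ofComplex_apply]))] with z hz hGz
        exact key z hz.1 hz.2 hGz)
    simpa only [ofComplex_apply] using h0
  -- case `D₁ ≠ 0`: the integral presentation
  refine Or.inr ?_
  have hw : (2 : ℤ) ≤ ((12 * e : ℕ) : ℤ) + (((12 * e : ℕ) : ℤ) + (((12 * e : ℕ) : ℤ) + 2)) := by push_cast; omega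
  have hfix := fun σ : ℂ ≃+* ℂ ↦ mapLaurent_paramRatio h hf hrat hq₂ hq₃ (cn := -2 * (D.c : ℂ)) (κ₀ := κ₀)
    (a1c := (W.a₁ : ℂ) * D.c) (c3 := (D.c : ℂ) ^ 3 * W.a₃)
    ⟨-2 * (D.c : ℚ), by push_cast; ring⟩ ⟨(D.c : ℚ) ^ 2 * W.b₂ / 12, by rw [hκ₀]; push_cast; ring⟩
    ⟨W.a₁ * (D.c : ℚ), by push_cast; ring⟩ ⟨(D.c : ℚ) ^ 3 * W.a₃, by push_cast; ring⟩ σ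
  obtain ⟨Bn, Bd, hBd0, hBdint, -, hBB⟩ := exists_int_cuspForm_presentation hw N₁ D₁ hD₁0 hfix
  -- pointwise: `Bd·minimalParam = Bn` at regular points with `minimalY ≠ 0`
  have hpt : ∀ τ : ℍ, Bd τ * N₁ τ = Bn τ * D₁ τ := fun τ ↦ DFunLike.congr_fun hBB τ
  have hgood : ∀ z : ℂ, 0 < z.im → (D.c : ℂ) * eichlerIntegral D.f (ofComplex z) ∉ D.L.lattice →
      minimalY D (ofComplex z) ≠ 0 → (⇑Gf ∘ ofComplex) z ≠ 0 →
      Bd (ofComplex z) * minimalParam D (ofComplex z) - Bn (ofComplex z) = 0 := by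
    intro z hz hzL hY hGz
    have hzL' : eichlerIntegral D.f (ofComplex z) ∉ L'.lattice := fun h ↦ hzL ((hmem _).mp h)
    obtain ⟨hN, hD⟩ := hreg (ofComplex z) hzL'
    have h := hpt (ofComplex z)
    rw [hN, hD] at h
    rw [comp_apply, hGfτ] at hGz
    have hG3 : G (ofComplex z) ^ 3 * D.f (ofComplex z) ≠ 0 :=
      mul_ne_zero (pow_ne_zero _ (left_ne_zero_of_mul hGz)) (right_ne_zero_of_mul hGz)
    have h' : Bd (ofComplex z) * (-2 * (D.c : ℂ) * (shortX D (ofComplex z) - κ₀)) =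
        Bn (ofComplex z) * (2 * minimalY D (ofComplex z)) :=
      mul_left_cancel₀ hG3 (by linear_combination h)
    rw [minimalParam, ← hκ₀, mul_div_assoc', sub_eq_zero, div_eq_iff hY]
    linear_combination h' / 2
  have hall : ∀ τ : ℍ, (D.c : ℂ) * eichlerIntegral D.f τ ∉ D.L.lattice → minimalY D τ ≠ 0 →
      Bd τ * minimalParam D τ = Bn τ := by
    intro τ hτ hY
    have hτc : (D.c : ℂ) * eichlerIntegral D.f (ofComplex (τ : ℂ)) ∉ D.L.lattice := by rwa [ofComplex_apply]
    have hYc : minimalY D (ofComplex (τ : ℂ)) ≠ 0 := by rwa [ofComplex_apply]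
    have hcont : ContinuousAt (fun w ↦ Bd (ofComplex w) * minimalParam D (ofComplex w) - Bn (ofComplex w)) (τ : ℂ) := by
      obtain ⟨h1, -⟩ := hXan τ.im_pos hτc
      have hP : AnalyticAt ℂ (fun w ↦ minimalParam D (ofComplex w)) (τ : ℂ) := by
        simp only [minimalParam]
        exact ((analyticAt_const.mul (h1.sub analyticAt_const)).neg).div (hYan τ.im_pos hτc) hYc
      exact (((analyticOnNhd_cuspForm_comp_ofComplex Bd (τ : ℂ) τ.im_pos).mul hP).sub
        (analyticOnNhd_cuspForm_comp_ofComplex Bn (τ : ℂ) τ.im_pos)).continuousAt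
    have hev : ∀ᶠ z in 𝓝[≠] (τ : ℂ), (⇑Gf ∘ ofComplex) z ≠ 0 →
        Bd (ofComplex z) * minimalParam D (ofComplex z) - Bn (ofComplex z) = 0 := by
      have hYev : ∀ᶠ z in 𝓝 (τ : ℂ), minimalY D (ofComplex z) ≠ 0 :=
        (hYan τ.im_pos hτc).continuousAt.eventually_ne hYc
      filter_upwards [nhdsWithin_le_nhds (hopen (z₀ := (τ : ℂ)) τ.im_pos hτc), nhdsWithin_le_nhds hYev]
        with z hz hYz hGz
      exact hgood z hz.1 hz.2 hYz hGz
    simpa only [ofComplex_apply, sub_eq_zero] using eq_zero_of_continuousAt_of_eventually Gf hGf0 τ.im_pos hcont hev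
  -- fix the weight to `12(3e+1)` with the integer factor `f⁵`
  have hwt : (((12 * e : ℕ) : ℤ) + (((12 * e : ℕ) : ℤ) + (((12 * e : ℕ) : ℤ) + 2))) + (5 : ℕ) * 2 = 12 * ((3 * e + 1 : ℕ) : ℤ) := by
    push_cast; ring
  set Bd' : ModularForm (Gamma0 N) (12 * ((3 * e + 1 : ℕ) : ℤ)) :=
    ((Bd : ModularForm (Gamma0 N) (((12 * e : ℕ) : ℤ) + (((12 * e : ℕ) : ℤ) + (((12 * e : ℕ) : ℤ) + 2)))).mul (fm.pow 5)).mcast hwt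
    with hBd'
  set Bn' : ModularForm (Gamma0 N) (12 * ((3 * e + 1 : ℕ) : ℤ)) :=
    ((Bn : ModularForm (Gamma0 N) (((12 * e : ℕ) : ℤ) + (((12 * e : ℕ) : ℤ) + (((12 * e : ℕ) : ℤ) + 2)))).mul (fm.pow 5)).mcast hwt
    with hBn'
  set pBd : PowerSeries ℤ := PowerSeries.mk fun m ↦ (hBdint m).choose with hpBd
  set pf : PowerSeries ℤ := PowerSeries.mk fun m ↦ W.LFunction m with hpf
  have hqBd : qExpansion 1 ⇑(Bd : ModularForm (Gamma0 N) (((12 * e : ℕ) : ℤ) + (((12 * e : ℕ) : ℤ) + (((12 * e : ℕ) : ℤ) + 2)))) =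
      pBd.map (Int.castRingHom ℂ) := by
    ext m; rw [coeff_map, hpBd, PowerSeries.coeff_mk]; exact (hBdint m).choose_spec
  have hqf : qExpansion 1 ⇑fm = pf.map (Int.castRingHom ℂ) := by
    ext m; rw [coeff_map, hpf, PowerSeries.coeff_mk]; exact D.isNewformOf.2 m
  have hqBd' : ∀ m, (qExpansion 1 ⇑Bd').coeff m = ((pBd * pf ^ 5).coeff m : ℤ) := by
    intro m
    rw [hBd', ModularForm.qExpansion_mcast, ModularForm.qExpansion_mul one_pos (one_mem_strictPeriods_coe_gamma0 N),
      ModularForm.qExpansion_pow one_pos (one_mem_strictPeriods_coe_gamma0 N), hqBd, hqf, ← map_pow, ← map_mul,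
      coeff_map]
    rfl
  refine ⟨Bn', Bd', fun m ↦ (pBd * pf ^ 5).coeff m, ?_, fun τ ↦ hasSum_int_qExpansion _ _ hqBd' τ, fun τ hτ hY ↦ ?_⟩
  · intro h0
    have h1 : qExpansionL N Bd' = 0 := by rw [h0, qExpansionL_zero]
    rw [hBd', qExpansionL_mcast, qExpansionL_mul, qExpansionL_pow, mul_eq_zero] at h1
    exact h1.elim (fun h1 ↦ hBd0 (by rw [qExpansionL_eq_zero_iff] at h1; exact DFunLike.ext _ _ fun τ ↦ DFunLike.congr_fun h1 τ))
      fun h1 ↦ hfm0 (pow_eq_zero_iff'.mp h1).1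
  · have h := hall τ hτ hY
    rw [hBd', hBn', ModularForm.coe_mcast, ModularForm.coe_mcast, ModularForm.coe_mul, ModularForm.coe_mul, Pi.mul_apply,
      Pi.mul_apply]
    change Bd τ * (fm.pow 5) τ * minimalParam D τ = Bn τ * (fm.pow 5) τ
    rw [mul_right_comm, h]

end Core

/-- **(RATB) `KummerMinimalParamPresentation`, BY NAME.** [cite: ShimuraIATAF1971, Thm. 3.52 and Thm. 7.14] -/
theorem kummerMinimalParamPresentation_holds : UDCKummerWitnessLine.KummerMinimalParamPresentation := by
  intro W _ _ N _ D acoef _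
  classical
  -- the degenerate cases: `y_W∘φ ≡ 0` off `φ⁻¹(O)` makes the statement vacuous (`Bd := Δ`, `Bn := 0`)
  obtain ⟨Bd₀, bd₀, hBd₀, hsum₀⟩ := exists_int_modularForm_twelve (N := N)
  have vacuous : (∀ τ : ℍ, (D.c : ℂ) * eichlerIntegral D.f τ ∉ D.L.lattice → minimalY D τ = 0) →
      ∃ (m : ℕ) (Bn Bd : ModularForm (Gamma0 N) (12 * (m : ℤ))) (bd : ℕ → ℤ), Bd ≠ 0 ∧
        (∀ τ : ℍ, HasSum (fun n : ℕ ↦ (bd n : ℂ) * Complex.exp (2 * Real.pi * Complex.I * (τ : ℂ) * n)) (Bd τ)) ∧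
        ∀ τ : ℍ, (D.c : ℂ) * eichlerIntegral D.f τ ∉ D.L.lattice → minimalY D τ ≠ 0 →
          Bd τ * minimalParam D τ = Bn τ := fun hall ↦
    ⟨1, 0, Bd₀, bd₀, hBd₀, hsum₀, fun τ hτ hY ↦ (hY (hall τ hτ)).elim⟩
  by_cases hc : D.c = 0
  · exact vacuous fun τ hτ ↦ (hτ (by rw [hc, Int.cast_zero, zero_mul]; exact zero_mem _)).elim
  -- the lattice `c⁻¹Λ_W` and the arithmetic data (as in `kummerPoleValuesAlgebraic_holds`)
  have hc0 : (D.c : ℂ) ≠ 0 := Int.cast_ne_zero.mpr hc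
  have hc' : ((D.c : ℂ))⁻¹ ≠ 0 := inv_ne_zero hc0
  set L' : PeriodPair := D.L.mulLeft ((D.c : ℂ))⁻¹ hc' with hL'
  have hmem : ∀ x : ℂ, x ∈ L'.lattice ↔ (D.c : ℂ) * x ∈ D.L.lattice := fun x ↦ by
    rw [hL', PeriodPair.mem_mulLeft_lattice, inv_inv]
  have hΛ : ∀ x ∈ periodLattice D.f, x ∈ L'.lattice := fun x hx ↦ (hmem x).mpr (D.smul_periodLattice_le x hx)
  have hf : D.f ≠ 0 := D.isNewformOf.1.ne_zero
  have hq₂ : ∃ q : ℚ, (q : ℂ) = L'.g₂ := by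
    refine ⟨(D.c : ℚ) ^ 4 * (W.c₄ / 12), ?_⟩
    rw [hL', PeriodPair.g₂_mulLeft, D.isNeronLattice.1, inv_pow, inv_inv, WeierstrassCurve.baseChange,
      WeierstrassCurve.map_c₄, eq_ratCast]
    push_cast; ring
  have hq₃ : ∃ q : ℚ, (q : ℂ) = L'.g₃ := by
    refine ⟨(D.c : ℚ) ^ 6 * (W.c₆ / 216), ?_⟩
    rw [hL', PeriodPair.g₃_mulLeft, D.isNeronLattice.2, inv_pow, inv_inv, WeierstrassCurve.baseChange,
      WeierstrassCurve.map_c₆, eq_ratCast]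
    push_cast; ring
  have hPx : ∀ τ : ℍ, ℘[L'] (eichlerIntegral D.f τ) = shortX D τ := by
    intro τ
    have h1 := PeriodPair.weierstrassP_mulLeft ((D.c : ℂ))⁻¹ hc' D.L ((D.c : ℂ) * eichlerIntegral D.f τ)
    rw [← mul_assoc, inv_mul_cancel₀ hc0, one_mul] at h1
    rw [shortX, h1, inv_pow, inv_inv]
  have hPy : ∀ τ : ℍ, ℘'[L'] (eichlerIntegral D.f τ) = 2 * shortY D τ := by
    intro τ
    have h1 := PeriodPair.derivWeierstrassP_mulLeft ((D.c : ℂ))⁻¹ hc' D.L ((D.c : ℂ) * eichlerIntegral D.f τ)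
    rw [← mul_assoc, inv_mul_cancel₀ hc0, one_mul] at h1
    rw [shortY, h1, inv_pow, inv_inv]; ring
  -- the explicit presentation (weight `12(a + Σ n)`) and the core
  obtain ⟨S, n, a, ha, F, -, -, hpres⟩ := exists_explicit_presentation D.f hf L' hΛ
  rcases ratb_core D hpres (a + ∑ s ∈ S, n s) rfl hmem hq₂ hq₃ hPx hPy with hall | ⟨Bn, Bd, bd, h⟩
  · exact vacuous hall
  · exact ⟨_, Bn, Bd, bd, h⟩

/-- **B-line piece (RATB) with a stub-style name** (an/p2 design `UDCKummerWitnessLineB`):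
`KummerMinimalParamPresentation` holds unconditionally. -/
theorem stub_kummerMinimalParamPresentation : KummerMinimalParamPresentation :=
  kummerMinimalParamPresentation_holds

end Summit.BirchSwinnertonDyer.BirchSwinnertonDyer.Theorems.ManinLocalTwoThree.ParamPoleJ

end
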